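import Summits.CriticalPhenomena.PercolationContinuityZ3.Theorems.PercNearOneGluingNoHeavyLowerTailSahiThreeCopyBlocks
import Summits.CriticalPhenomena.PercolationContinuityZ3.Theorems.PercNearOneGluingNoHeavyLowerTailSahiThreeCopyLiterals

/-!
# `NoHeavyLowerTail` (crux stmt-CriticalPhenomena-4575), Sahi programme: **3C-SAHI IS CLOSED UNDER BLOCK-OR** — if `(g,g',g'')` on `{0,1}^m` and
# `(f,f',f'')` on `{0,1}^d` (values in `[0,1]`, monotone) satisfy the three-copy Sahi inequality at profiles `b_f`, `b_b`, then the disjoint-block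
# disjunctions `(g ∨ f, g' ∨ f', g'' ∨ f'')`, `(g ∨ f)(x) = 1 − (1−g(x_front))(1−f(x_back))`, satisfy it at the concatenated profile

Support file (Sahi cell, seat `prim-sahi-p1`, generation 54; `--supports stmt-CriticalPhenomena-4575`); companion of `…SahiThreeCopyBlocks` (block-AND closure,
`tens`, `N3_tens`) and `…SahiThreeCopyLiterals` (complement Harris identities).  Pure proofs plus one definition (`orTens`); no `sorry`, standard axioms.
With `…Blocks` this makes the class of triples satisfying the census conjecture 3C-SAHI (CENSUS §175 W197) at every profile CLOSED UNDER COMMON MONOTONE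
READ-ONCE COMPOSITION (disjoint `∧` and `∨` of settled triples); bases in the tree: one cumulation slot (`…Cylinder`), two nested slots (`…Nested`), OR-events
(`…OrEvents`), literals (`…Literals`).

THE MECHANISM (memo FROM-prim-sahi-p1-gen54-READONCE-CLOSURE §3).  By `tc_compl` and the block factorisation `N3_tens`, the claim is `Φ(V ⊙ W) ≥ 0` for the
eleven-vectors `V, W` of the two complement triples (`Φ = ΣH − c`, `⊙` = coordinatewise product).  There is NO product-form certificate (HiGHS LPs, kit
j328100/j328101), so the proof is a TRANSPORT argument:
* ★ `transport_lemma`: the inequalities valid for every realizable `V` — Harris `s ≤ h`, the three union-Harris inequalities `H_uv + H_uw − n0 + nA ≥ 0`,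
  `Φ(V) ≥ 0`, and the chain `n3 ≤ nA, nB, nC, n0` — yield an explicit measure on the atoms `{111, 110, 101, 011, 100, 010, 001}` (extra triple mass
  `s = (Σe − 2M)⁺`, doubles from the box `[ℓ, cap]` summing to `τ = (Σe′ − M′)⁺`, singles) meeting the bit demands `n0 − H_i`, the pair caps `nA, nB, nC` and
  total mass `≤ n0` — i.e. `V` Φ-dominates an element of the 16-generator OR-cone (its facets are exactly these inequalities; exact double description in the memo).
* ★ `blockOr_key_ineq`: then `Φ(V ⊙ W) = Σ_atoms μ_a·Φ(T_a ⊙ W) + Σ λ_i H_i(W) + (domination slack)`, an identity checked by `linarith`, every term nonnegative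
  by the SAME facet inequalities for `W` (`Φ(T_a ⊙ W)` is `Φ(W)`, `Φ(W)+n3`, a union-Harris or a Harris expression).
* `orConeFacts_compl`: realizable complement triples satisfy the facet inequalities (three-copy Harris `N3_le_N3_mul` through `harris_compl`,
  `unionHarris_compl`, `split3_compl`, `harrisOr_compl`).
* ★★ `tc_orTens_nonneg` / `tc_orTens_nonneg_all` (every profile) / events form `tc_orTens_setInd_nonneg` (`A₁ ∨ A₂ = {x : x_front ∈ A₁ or x_back ∈ A₂}`).
[this work; conjecture: CENSUS §175 W197 (prim-sahi-census gen 54)]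
-/

namespace Summit.CriticalPhenomena.PercolationContinuityZ3.Theorems.SahiThreeCopy

open Finset Function Literature.Combinatorics.Sahi2008
open scoped BigOperators

noncomputable section

variable {d : ℕ}

/-! ### §1 The transport lemma (real arithmetic) -/

/-- `max 0 a + max 0 b ≤ c` from the bounds on all partial sums. [this work] -/
theorem pos_add_pos_le {a b c : ℝ} (hab : a + b ≤ c) (ha : a ≤ c) (hb : b ≤ c) (h0 : 0 ≤ c) : max 0 a + max 0 b ≤ c := by
  rcases le_total 0 a with h1 | h1 <;> rcases le_total 0 b with h2 | h2 <;>
    simp only [max_eq_right h1, max_eq_left h1, max_eq_right h2, max_eq_left h2] <;> linarith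

/-- `max 0 a + max 0 b + max 0 c ≤ C` from the bounds on all partial sums. [this work] -/
theorem pos3_le {a b c C : ℝ} (habc : a + b + c ≤ C) (hab : a + b ≤ C) (hac : a + c ≤ C) (hbc : b + c ≤ C) (ha : a ≤ C) (hb : b ≤ C)
    (hc : c ≤ C) (h0 : 0 ≤ C) : max 0 a + max 0 b + max 0 c ≤ C := by
  rcases le_total 0 a with h1 | h1 <;> rcases le_total 0 b with h2 | h2 <;> rcases le_total 0 c with h3 | h3 <;>
    simp only [max_eq_right h1, max_eq_left h1, max_eq_right h2, max_eq_left h2, max_eq_right h3, max_eq_left h3] <;> linarith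

/-- ★ **The transport lemma** (memo FROM-prim-sahi-p1-gen54 §3c): the facet inequalities of the OR-cone (Harris `s ≤ h`, the three union-Harris
inequalities, `Φ ≥ 0`, and the chain `n3 ≤ nA, nB, nC, n0`) imply the existence of a transport measure on the atoms `111 (n3 + s), 110 (p), 101 (q),
011 (r), 100 (σx), 010 (σy), 001 (σz)` of total mass `≤ n0`, meeting the bit demands `n0 − H_i` and the pair caps `nA, nB, nC`.  Explicit witness:
extra triple `s = (Σe − 2M)⁺`, then doubles from the box `[ℓ, cap]` with sum `τ = (Σe' − M')⁺`, then singles. [this work] -/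
theorem transport_lemma {huv suv huw suw hvw svw n0 nA nB nC n3 : ℝ} (cA : n3 ≤ nA) (cB : n3 ≤ nB) (cC : n3 ≤ nC)
    (c0 : n3 ≤ n0) (H1 : suv ≤ huv) (H2 : suw ≤ huw) (H3 : svw ≤ hvw) (Uu : n0 ≤ (huv - suv) + (huw - suw) + nA)
    (Uv : n0 ≤ (huv - suv) + (hvw - svw) + nB) (Uw : n0 ≤ (huw - suw) + (hvw - svw) + nC)
    (hΦ : 2 * n0 + n3 ≤ (huv - suv) + (huw - suw) + (hvw - svw) + nA + nB + nC) :
    ∃ s p q r σx σy σz : ℝ, 0 ≤ s ∧ 0 ≤ p ∧ 0 ≤ q ∧ 0 ≤ r ∧ 0 ≤ σx ∧ 0 ≤ σy ∧ 0 ≤ σz ∧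
      n3 + s + p + q + r + σx + σy + σz ≤ n0 ∧
      n0 - (huv - suv) ≤ n3 + s + p + q + σx ∧ n0 - (huw - suw) ≤ n3 + s + p + r + σy ∧ n0 - (hvw - svw) ≤ n3 + s + q + r + σz ∧
      n3 + s + p ≤ nA ∧ n3 + s + q ≤ nB ∧ n3 + s + r ≤ nC := by
  -- reduced data
  set M := n0 - n3 with hM
  set A := nA - n3 with hA
  set B := nB - n3 with hB
  set C := nC - n3 with hC
  have M0 : 0 ≤ M := by linarith
  have A0 : 0 ≤ A := by linarith
  have B0 : 0 ≤ B := by linarith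
  have C0 : 0 ≤ C := by linarith
  set ex := max 0 (n0 - (huv - suv) - n3) with hex
  set ey := max 0 (n0 - (huw - suw) - n3) with hey
  set ez := max 0 (n0 - (hvw - svw) - n3) with hez
  have ex0 : 0 ≤ ex := le_max_left _ _
  have ey0 : 0 ≤ ey := le_max_left _ _
  have ez0 : 0 ≤ ez := le_max_left _ _
  have exd : n0 - (huv - suv) - n3 ≤ ex := le_max_right _ _
  have eyd : n0 - (huw - suw) - n3 ≤ ey := le_max_right _ _
  have ezd : n0 - (hvw - svw) - n3 ≤ ez := le_max_right _ _
  have exM : ex ≤ M := max_le M0 (by linarith)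
  have eyM : ey ≤ M := max_le M0 (by linarith)
  have ezM : ez ≤ M := max_le M0 (by linarith)
  have exy : ex + ey ≤ M + A := pos_add_pos_le (by linarith) (by linarith) (by linarith) (by linarith)
  have exz : ex + ez ≤ M + B := pos_add_pos_le (by linarith) (by linarith) (by linarith) (by linarith)
  have eyz : ey + ez ≤ M + C := pos_add_pos_le (by linarith) (by linarith) (by linarith) (by linarith)
  have exyz : ex + ey + ez ≤ M + A + B + C :=
    pos3_le (by linarith) (by linarith) (by linarith) (by linarith) (by linarith) (by linarith) (by linarith) (by linarith)
  -- extra triple mass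
  set s := max 0 (ex + ey + ez - 2 * M) with hs
  have s0 : 0 ≤ s := le_max_left _ _
  have s_ge : ex + ey + ez - 2 * M ≤ s := le_max_right _ _
  have s_ex : s ≤ ex := max_le ex0 (by linarith)
  have s_ey : s ≤ ey := max_le ey0 (by linarith)
  have s_ez : s ≤ ez := max_le ez0 (by linarith)
  have s_A : s ≤ A := max_le A0 (by linarith)
  have s_B : s ≤ B := max_le B0 (by linarith)
  have s_C : s ≤ C := max_le C0 (by linarith)
  have s_sum : s + (ex + ey + ez) ≤ M + A + B + C := by
    rcases le_total 0 (ex + ey + ez - 2 * M) with h | h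
    · rw [max_eq_right h] at hs; rw [hs]; linarith
    · rw [max_eq_left h] at hs; rw [hs]; linarith
  -- the doubles target
  set τ := max 0 (ex + ey + ez - 3 * s - (M - s)) with hτ
  have τ0 : 0 ≤ τ := le_max_left _ _
  have τ_ge : ex + ey + ez - 3 * s - (M - s) ≤ τ := le_max_right _ _
  have τ_2 : 2 * τ ≤ ex + ey + ez - 3 * s := by
    rcases le_total 0 (ex + ey + ez - 3 * s - (M - s)) with h | h
    · rw [max_eq_right h] at hτ; rw [hτ]; linarith
    · rw [max_eq_left h] at hτ; rw [hτ]; linarith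
  have τ_xy : τ ≤ (ex - s) + (ey - s) := max_le (by linarith) (by linarith)
  have τ_xz : τ ≤ (ex - s) + (ez - s) := max_le (by linarith) (by linarith)
  have τ_yz : τ ≤ (ey - s) + (ez - s) := max_le (by linarith) (by linarith)
  have τ_A : τ ≤ (A - s) + (ez - s) := max_le (by linarith) (by linarith)
  have τ_B : τ ≤ (B - s) + (ey - s) := max_le (by linarith) (by linarith)
  have τ_C : τ ≤ (C - s) + (ex - s) := max_le (by linarith) (by linarith)
  have τ_ABC : τ ≤ (A - s) + (B - s) + (C - s) := max_le (by linarith) (by linarith)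
  -- lower bounds of the box
  set lp := max 0 (τ - (ez - s)) with hlp
  set lq := max 0 (τ - (ey - s)) with hlq
  set lr := max 0 (τ - (ex - s)) with hlr
  have lp0 : 0 ≤ lp := le_max_left _ _
  have lq0 : 0 ≤ lq := le_max_left _ _
  have lr0 : 0 ≤ lr := le_max_left _ _
  have lpd : τ - (ez - s) ≤ lp := le_max_right _ _
  have lqd : τ - (ey - s) ≤ lq := le_max_right _ _
  have lrd : τ - (ex - s) ≤ lr := le_max_right _ _
  have lpA : lp ≤ A - s := max_le (by linarith) (by linarith)
  have lqB : lq ≤ B - s := max_le (by linarith) (by linarith)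
  have lrC : lr ≤ C - s := max_le (by linarith) (by linarith)
  have lsum : lp + lq + lr ≤ τ :=
    pos3_le (by linarith) (by linarith) (by linarith) (by linarith) (by linarith) (by linarith) (by linarith) τ0
  -- the doubles
  set p := min (A - s) (τ - lq - lr) with hp
  have p_A : p ≤ A - s := min_le_left _ _
  have p_le : p ≤ τ - lq - lr := min_le_right _ _
  have p_ge : lp ≤ p := le_min lpA (by linarith)
  set q := min (B - s) (τ - p - lr) with hq
  have q_B : q ≤ B - s := min_le_left _ _
  have q_le : q ≤ τ - p - lr := min_le_right _ _
  have q_ge : lq ≤ q := le_min lqB (by linarith)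
  set r := τ - p - q with hr
  have r_ge : lr ≤ r := by rw [hr]; linarith
  have r_C : r ≤ C - s := by
    rcases min_choice (A - s) (τ - lq - lr) with h1 | h1 <;> rcases min_choice (B - s) (τ - p - lr) with h2 | h2 <;>
      rw [← hp] at h1 <;> rw [← hq] at h2 <;> rw [hr] <;> linarith
  have pq : p + q ≤ ex - s := by linarith
  have pr : p + r ≤ ey - s := by linarith
  have qr : q + r ≤ ez - s := by linarith
  refine ⟨s, p, q, r, (ex - s) - p - q, (ey - s) - p - r, (ez - s) - q - r, s0, by linarith, by linarith, by linarith, by linarith,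
    by linarith, by linarith, ?_, ?_, ?_, ?_, by linarith, by linarith, by linarith⟩
  · -- total mass
    linarith
  · linarith
  · linarith
  · linarith

/-! ### §2 The facet inequalities and the key bilinear inequality -/

/-- The inequalities satisfied by the eleven-vector `(h_uv,s_uv,h_uw,s_uw,h_vw,s_vw,n0,nA,nB,nC,n3)` of every realizable triple whose complement satisfies
3C-SAHI at the profile: nonnegativity, Harris, `h ≥ n0`, union-Harris, `Φ ≥ 0`, chains. [this work] -/
structure OrConeFacts (huv suv huw suw hvw svw n0 nA nB nC n3 : ℝ) : Prop where
  suv0 : 0 ≤ suv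
  suw0 : 0 ≤ suw
  svw0 : 0 ≤ svw
  n00 : 0 ≤ n0
  nA0 : 0 ≤ nA
  nB0 : 0 ≤ nB
  nC0 : 0 ≤ nC
  n30 : 0 ≤ n3
  H1 : suv ≤ huv
  H2 : suw ≤ huw
  H3 : svw ≤ hvw
  M1 : n0 ≤ huv
  M2 : n0 ≤ huw
  M3 : n0 ≤ hvw
  Uu : n0 ≤ (huv - suv) + (huw - suw) + nA
  Uv : n0 ≤ (huv - suv) + (hvw - svw) + nB
  Uw : n0 ≤ (huw - suw) + (hvw - svw) + nC
  Phi : 2 * n0 + n3 ≤ (huv - suv) + (huw - suw) + (hvw - svw) + nA + nB + nC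
  cA : n3 ≤ nA
  cB : n3 ≤ nB
  cC : n3 ≤ nC
  c0 : n3 ≤ n0

/-- ★ **The key bilinear inequality `Φ(V ⊙ W) ≥ 0`** for two eleven-vectors satisfying the facet inequalities (transport for `V`, linear certificates for
`W`). [this work] -/
theorem blockOr_key_ineq {Vhuv Vsuv Vhuw Vsuw Vhvw Vsvw Vn0 VnA VnB VnC Vn3 Whuv Wsuv Whuw Wsuw Whvw Wsvw Wn0 WnA WnB WnC Wn3 : ℝ}
    (hV : OrConeFacts Vhuv Vsuv Vhuw Vsuw Vhvw Vsvw Vn0 VnA VnB VnC Vn3) (hW : OrConeFacts Whuv Wsuv Whuw Wsuw Whvw Wsvw Wn0 WnA WnB WnC Wn3) :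
    0 ≤ (Vhuv * Whuv - Vsuv * Wsuv) + (Vhuw * Whuw - Vsuw * Wsuw) + (Vhvw * Whvw - Vsvw * Wsvw) -
      (2 * (Vn0 * Wn0) - (VnA * WnA + VnB * WnB + VnC * WnC) + Vn3 * Wn3) := by
  obtain ⟨s, p, q, r, σx, σy, σz, s0, p0, q0, r0, σx0, σy0, σz0, htot, hbx, hby, hbz, hpA, hpB, hpC⟩ :=
    transport_lemma hV.cA hV.cB hV.cC hV.c0 hV.H1 hV.H2 hV.H3 hV.Uu hV.Uv hV.Uw hV.Phi
  -- the nine atom forms for W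
  have O000 : 0 ≤ Whuv + Whuw + Whvw - 2 * Wn0 := by linarith [hW.M1, hW.M2, hW.M3, hW.n00]
  have O100 : 0 ≤ Whuv + Whuw + Whvw - 2 * Wn0 - Wsuv := by linarith [hW.H1, hW.M2, hW.M3]
  have O010 : 0 ≤ Whuv + Whuw + Whvw - 2 * Wn0 - Wsuw := by linarith [hW.H2, hW.M1, hW.M3]
  have O001 : 0 ≤ Whuv + Whuw + Whvw - 2 * Wn0 - Wsvw := by linarith [hW.H3, hW.M1, hW.M2]
  have O110 : 0 ≤ Whuv + Whuw + Whvw - 2 * Wn0 - Wsuv - Wsuw + WnA := by linarith [hW.Uu, hW.M3]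
  have O101 : 0 ≤ Whuv + Whuw + Whvw - 2 * Wn0 - Wsuv - Wsvw + WnB := by linarith [hW.Uv, hW.M2]
  have O011 : 0 ≤ Whuv + Whuw + Whvw - 2 * Wn0 - Wsuw - Wsvw + WnC := by linarith [hW.Uw, hW.M1]
  have O1110 : 0 ≤ (Whuv - Wsuv) + (Whuw - Wsuw) + (Whvw - Wsvw) - 2 * Wn0 + WnA + WnB + WnC := by linarith [hW.Phi, hW.n30]
  have O1111 : 0 ≤ (Whuv - Wsuv) + (Whuw - Wsuw) + (Whvw - Wsvw) - 2 * Wn0 + WnA + WnB + WnC - Wn3 := by linarith [hW.Phi]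
  have HW1 : 0 ≤ Whuv - Wsuv := by linarith [hW.H1]
  have HW2 : 0 ≤ Whuw - Wsuw := by linarith [hW.H2]
  have HW3 : 0 ≤ Whvw - Wsvw := by linarith [hW.H3]
  -- filler and pair slacks
  have hω : 0 ≤ Vn0 - (Vn3 + s + p + q + r + σx + σy + σz) := by linarith
  have l1 : 0 ≤ Vhuv - Vn0 := by linarith [hV.M1]
  have l2 : 0 ≤ Vhuw - Vn0 := by linarith [hV.M2]
  have l3 : 0 ≤ Vhvw - Vn0 := by linarith [hV.M3]
  have dx : 0 ≤ (Vn3 + s + p + q + σx) + (Vhuv - Vn0) - Vsuv := by linarith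
  have dy : 0 ≤ (Vn3 + s + p + r + σy) + (Vhuw - Vn0) - Vsuw := by linarith
  have dz : 0 ≤ (Vn3 + s + q + r + σz) + (Vhvw - Vn0) - Vsvw := by linarith
  have eA : 0 ≤ VnA - (Vn3 + s + p) := by linarith
  have eB : 0 ≤ VnB - (Vn3 + s + q) := by linarith
  have eC : 0 ≤ VnC - (Vn3 + s + r) := by linarith
  linarith [mul_nonneg hω O000, mul_nonneg σx0 O100, mul_nonneg σy0 O010, mul_nonneg σz0 O001, mul_nonneg p0 O110, mul_nonneg q0 O101,
    mul_nonneg r0 O011, mul_nonneg s0 O1110, mul_nonneg hV.n30 O1111, mul_nonneg l1 HW1, mul_nonneg l2 HW2, mul_nonneg l3 HW3,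
    mul_nonneg dx hW.suv0, mul_nonneg dy hW.suw0, mul_nonneg dz hW.svw0, mul_nonneg eA hW.nA0, mul_nonneg eB hW.nB0, mul_nonneg eC hW.nC0]

/-! ### §3 Realizable complement triples satisfy the facet inequalities -/

/-- Spectator-Harris gap in complement coordinates: `N_b(u; v̄w̄; 1) − N_b(u; v̄; w̄) = N_b(u; gh; 1) − N_b(u; g; h)` for `v̄ = 1−g`, `w̄ = 1−h`. [this work] -/
theorem split3_compl (b : Fin d → ℕ) (u g h : Pt d → ℝ) :
    N3 b u ((1 - g) * (1 - h)) 1 - N3 b u (1 - g) (1 - h) = N3 b u (g * h) 1 - N3 b u g h := by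
  have e : (1 - g) * (1 - h) = 1 - g - h + g * h := by ring
  rw [e, N3_add_mid, N3_sub_mid, N3_sub_mid, N3_sub_mid, N3_sub_right, N3_sub_right, N3_comm23 b u 1 h]
  ring

/-- The Harris gap of `ū` and `v̄w̄` in complement coordinates is the Harris gap of `f` and `g ∨ h = g + h − gh`. [this work] -/
theorem harrisOr_compl (b : Fin d → ℕ) (f g h : Pt d → ℝ) :
    N3 b ((1 - f) * (1 - g) * (1 - h)) 1 1 - N3 b (1 - f) ((1 - g) * (1 - h)) 1 =
      N3 b (f * (g + h - g * h)) 1 1 - N3 b f (g + h - g * h) 1 := by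
  have e0 := unionHarris_compl b f g h
  rw [harris_compl, harris_compl] at e0
  have l1 : N3 b (f * (g + h - g * h)) 1 1 = N3 b (f * g) 1 1 + N3 b (f * h) 1 1 - N3 b (f * (g * h)) 1 1 := by
    rw [show f * (g + h - g * h) = f * g + f * h - f * (g * h) by ring, N3_sub_left, N3_add_left]
  have l2 : N3 b f (g + h - g * h) 1 = N3 b f g 1 + N3 b f h 1 - N3 b f (g * h) 1 := by
    rw [N3_sub_mid, N3_add_mid]
  linarith

/-- `g ∨ h = g + h − gh` is nonnegative and monotone for monotone `g, h` with values in `[0,1]`. [this work] -/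
theorem orFun_props {g h : Pt d → ℝ} (hg0 : ∀ x, 0 ≤ g x) (hg1 : ∀ x, g x ≤ 1) (hgm : Monotone g) (hh0 : ∀ x, 0 ≤ h x) (hh1 : ∀ x, h x ≤ 1)
    (hhm : Monotone h) : (∀ x, 0 ≤ (g + h - g * h) x) ∧ Monotone (g + h - g * h) := by
  constructor
  · intro x
    simp only [Pi.add_apply, Pi.sub_apply, Pi.mul_apply]
    nlinarith [hg0 x, hh0 x, hg1 x, hh1 x]
  · intro x y hxy
    simp only [Pi.add_apply, Pi.sub_apply, Pi.mul_apply]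
    nlinarith [hgm hxy, hhm hxy, hg1 y, hh1 x, hg0 x, hh0 y, mul_nonneg (sub_nonneg.2 (hh1 y)) (sub_nonneg.2 (hgm hxy)),
      mul_nonneg (sub_nonneg.2 (hg1 x)) (sub_nonneg.2 (hhm hxy))]

/-- ★ **Realizable vectors satisfy the facets**: for monotone `f, g, h : {0,1}^d → [0,1]` with `0 ≤ c_b(f,g,h)`, the eleven-vector of the complement triple
`(1−f, 1−g, 1−h)` at `b` satisfies `OrConeFacts`. [this work] -/
theorem orConeFacts_compl (b : Fin d → ℕ) {f g h : Pt d → ℝ} (hf0 : ∀ x, 0 ≤ f x) (hf1 : ∀ x, f x ≤ 1) (hfm : Monotone f)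
    (hg0 : ∀ x, 0 ≤ g x) (hg1 : ∀ x, g x ≤ 1) (hgm : Monotone g) (hh0 : ∀ x, 0 ≤ h x) (hh1 : ∀ x, h x ≤ 1) (hhm : Monotone h)
    (htc : 0 ≤ tc b f g h) :
    OrConeFacts (N3 b ((1 - f) * (1 - g)) 1 1) (N3 b (1 - f) (1 - g) 1) (N3 b ((1 - f) * (1 - h)) 1 1) (N3 b (1 - f) (1 - h) 1)
      (N3 b ((1 - g) * (1 - h)) 1 1) (N3 b (1 - g) (1 - h) 1) (N3 b ((1 - f) * (1 - g) * (1 - h)) 1 1) (N3 b (1 - f) ((1 - g) * (1 - h)) 1)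
      (N3 b (1 - g) ((1 - f) * (1 - h)) 1) (N3 b (1 - h) ((1 - f) * (1 - g)) 1) (N3 b (1 - f) (1 - g) (1 - h)) := by
  have u0 : ∀ x, 0 ≤ (1 - f) x := fun x => sub_nonneg.2 (hf1 x)
  have v0 : ∀ x, 0 ≤ (1 - g) x := fun x => sub_nonneg.2 (hg1 x)
  have w0 : ∀ x, 0 ≤ (1 - h) x := fun x => sub_nonneg.2 (hh1 x)
  have u1 : ∀ x, (1 - f) x ≤ 1 := fun x => by simp [hf0 x]
  have v1 : ∀ x, (1 - g) x ≤ 1 := fun x => by simp [hg0 x]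
  have w1 : ∀ x, (1 - h) x ≤ 1 := fun x => by simp [hh0 x]
  have one0 : ∀ x : Pt d, (0 : ℝ) ≤ (1 : Pt d → ℝ) x := fun _ => zero_le_one
  have c21 : (1 - g) * (1 - f) = (1 - f) * (1 - g) := mul_comm _ _
  have c31 : (1 - h) * (1 - f) = (1 - f) * (1 - h) := mul_comm _ _
  have c32 : (1 - h) * (1 - g) = (1 - g) * (1 - h) := mul_comm _ _
  have c312 : (1 - f) * (1 - h) * (1 - g) = (1 - f) * (1 - g) * (1 - h) := by ring
  refine ⟨?_, ?_, ?_, ?_, ?_, ?_, ?_, ?_, ?_, ?_, ?_, ?_, ?_, ?_, ?_, ?_, ?_, ?_, ?_, ?_, ?_, ?_⟩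
  · exact N3_nonneg b u0 v0 one0
  · exact N3_nonneg b u0 w0 one0
  · exact N3_nonneg b v0 w0 one0
  · exact N3_nonneg b (fun x => mul_nonneg (mul_nonneg (u0 x) (v0 x)) (w0 x)) one0 one0
  · exact N3_nonneg b u0 (fun x => mul_nonneg (v0 x) (w0 x)) one0
  · exact N3_nonneg b v0 (fun x => mul_nonneg (u0 x) (w0 x)) one0
  · exact N3_nonneg b w0 (fun x => mul_nonneg (u0 x) (v0 x)) one0
  · exact N3_nonneg b u0 v0 w0
  · rw [← sub_nonneg, harris_compl]; exact harris3_nonneg b hf0 hfm hg0 hgm one0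
  · rw [← sub_nonneg, harris_compl]; exact harris3_nonneg b hf0 hfm hh0 hhm one0
  · rw [← sub_nonneg, harris_compl]; exact harris3_nonneg b hg0 hgm hh0 hhm one0
  · exact N3_mono_left b (fun x => by
      simp only [Pi.mul_apply]; exact mul_le_of_le_one_right (mul_nonneg (u0 x) (v0 x)) (w1 x)) one0 one0
  · exact N3_mono_left b (fun x => by
      simp only [Pi.mul_apply]; rw [mul_right_comm]; exact mul_le_of_le_one_right (mul_nonneg (u0 x) (w0 x)) (v1 x)) one0 one0
  · exact N3_mono_left b (fun x => by
      simp only [Pi.mul_apply]; rw [mul_assoc]; exact mul_le_of_le_one_left (mul_nonneg (v0 x) (w0 x)) (u1 x)) one0 one0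
  · have e := unionHarris_compl b f g h
    have : 0 ≤ N3 b (f * (g * h)) 1 1 - N3 b f (g * h) 1 :=
      harris3_nonneg b hf0 hfm (fun x => mul_nonneg (hg0 x) (hh0 x)) (hgm.mul hhm hg0 hh0) one0
    linarith
  · have e := unionHarris_compl b g f h
    rw [c21, N3_comm12 b (1 - g) (1 - f) 1] at e
    have : 0 ≤ N3 b (g * (f * h)) 1 1 - N3 b g (f * h) 1 :=
      harris3_nonneg b hg0 hgm (fun x => mul_nonneg (hf0 x) (hh0 x)) (hfm.mul hhm hf0 hh0) one0
    linarith
  · have e := unionHarris_compl b h f g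
    rw [c31, c32, c312, N3_comm12 b (1 - h) (1 - f) 1, N3_comm12 b (1 - h) (1 - g) 1] at e
    have : 0 ≤ N3 b (h * (f * g)) 1 1 - N3 b h (f * g) 1 :=
      harris3_nonneg b hh0 hhm (fun x => mul_nonneg (hf0 x) (hg0 x)) (hfm.mul hgm hf0 hg0) one0
    linarith
  · have e := tc_compl b (1 - f) (1 - g) (1 - h)
    simp only [sub_sub_cancel] at e
    unfold tc at e htc
    linarith
  · have e := split3_compl b (1 - f) g h
    have := N3_split3_le b u0 hg0 hgm hh0 hhm
    linarith
  · have e := split3_compl b (1 - g) f h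
    rw [N3_comm12 b (1 - g) (1 - f) (1 - h)] at e
    have := N3_split3_le b v0 hf0 hfm hh0 hhm
    linarith
  · have e := split3_compl b (1 - h) f g
    rw [N3_comm12 b (1 - h) (1 - f) (1 - g), N3_comm23 b (1 - f) (1 - h) (1 - g)] at e
    have := N3_split3_le b w0 hf0 hfm hg0 hgm
    linarith
  · -- n3 ≤ nA ≤ n0
    have e := split3_compl b (1 - f) g h
    have h1 := N3_split3_le b u0 hg0 hgm hh0 hhm
    have e2 := harrisOr_compl b f g h
    obtain ⟨o0, om⟩ := orFun_props hg0 hg1 hgm hh0 hh1 hhm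
    have h2 : 0 ≤ N3 b (f * (g + h - g * h)) 1 1 - N3 b f (g + h - g * h) 1 := harris3_nonneg b hf0 hfm o0 om one0
    linarith

/-! ### §4 Block-OR closure of 3C-SAHI -/

/-- The BLOCK DISJUNCTION `(g ∨ f)(x) = 1 − (1 − g(x_front))(1 − f(x_back))` (for indicators: the event `A₁ ∨ A₂` on disjoint blocks). [this work] -/
def orTens (m : ℕ) (g : Pt m → ℝ) (f : Pt d → ℝ) : Pt (d + m) → ℝ := 1 - tens m (1 - g) (1 - f)

/-- ★★ **BLOCK-OR CLOSURE OF 3C-SAHI.**  Monotone `g, g', g'' : {0,1}^m → [0,1]` and `f, f', f'' : {0,1}^d → [0,1]` with `0 ≤ c_{b_f}(g,g',g'')` and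
`0 ≤ c_{b_b}(f,f',f'')` give `0 ≤ c_{(b_f,b_b)}(g ∨ f, g' ∨ f', g'' ∨ f'')`. [this work] -/
theorem tc_orTens_nonneg (m : ℕ) (bf : Fin m → ℕ) (bb : Fin d → ℕ) {g g' g'' : Pt m → ℝ} {f f' f'' : Pt d → ℝ}
    (hg0 : ∀ y, 0 ≤ g y) (hg1 : ∀ y, g y ≤ 1) (hgm : Monotone g) (hg'0 : ∀ y, 0 ≤ g' y) (hg'1 : ∀ y, g' y ≤ 1) (hg'm : Monotone g')
    (hg''0 : ∀ y, 0 ≤ g'' y) (hg''1 : ∀ y, g'' y ≤ 1) (hg''m : Monotone g'')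
    (hf0 : ∀ x, 0 ≤ f x) (hf1 : ∀ x, f x ≤ 1) (hfm : Monotone f) (hf'0 : ∀ x, 0 ≤ f' x) (hf'1 : ∀ x, f' x ≤ 1) (hf'm : Monotone f')
    (hf''0 : ∀ x, 0 ≤ f'' x) (hf''1 : ∀ x, f'' x ≤ 1) (hf''m : Monotone f'')
    (htg : 0 ≤ tc bf g g' g'') (htf : 0 ≤ tc bb f f' f'') :
    0 ≤ tc (appendProf m bf bb) (orTens m g f) (orTens m g' f') (orTens m g'' f'') := by
  have hV := orConeFacts_compl bf hg0 hg1 hgm hg'0 hg'1 hg'm hg''0 hg''1 hg''m htg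
  have hW := orConeFacts_compl bb hf0 hf1 hfm hf'0 hf'1 hf'm hf''0 hf''1 hf''m htf
  have key := blockOr_key_ineq hV hW
  unfold orTens
  rw [tc_compl]
  unfold tc
  simp only [tens_mul]
  rw [← tens_one m]
  simp only [N3_tens]
  linarith

/-- **Block-OR closure at all profiles.** [this work] -/
theorem tc_orTens_nonneg_all (m : ℕ) {g g' g'' : Pt m → ℝ} {f f' f'' : Pt d → ℝ}
    (hg0 : ∀ y, 0 ≤ g y) (hg1 : ∀ y, g y ≤ 1) (hgm : Monotone g) (hg'0 : ∀ y, 0 ≤ g' y) (hg'1 : ∀ y, g' y ≤ 1) (hg'm : Monotone g')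
    (hg''0 : ∀ y, 0 ≤ g'' y) (hg''1 : ∀ y, g'' y ≤ 1) (hg''m : Monotone g'')
    (hf0 : ∀ x, 0 ≤ f x) (hf1 : ∀ x, f x ≤ 1) (hfm : Monotone f) (hf'0 : ∀ x, 0 ≤ f' x) (hf'1 : ∀ x, f' x ≤ 1) (hf'm : Monotone f')
    (hf''0 : ∀ x, 0 ≤ f'' x) (hf''1 : ∀ x, f'' x ≤ 1) (hf''m : Monotone f'')
    (htg : ∀ bf, 0 ≤ tc bf g g' g'') (htf : ∀ bb, 0 ≤ tc bb f f' f'') (b : Fin (d + m) → ℕ) :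
    0 ≤ tc b (orTens m g f) (orTens m g' f') (orTens m g'' f'') := by
  obtain ⟨bf, bb, rfl⟩ := exists_appendProf m b
  exact tc_orTens_nonneg m bf bb hg0 hg1 hgm hg'0 hg'1 hg'm hg''0 hg''1 hg''m hf0 hf1 hfm hf'0 hf'1 hf'm hf''0 hf''1 hf''m (htg bf) (htf bb)

/-- Indicators take values in `[0,1]`. [this work] -/
theorem setInd_le_one'' {n : ℕ} (A : Finset (Pt n)) (x : Pt n) : setInd A x ≤ 1 := by
  unfold setInd; split_ifs <;> norm_num

/-- Events form: for up-set triples `(A₁,B₁,C₁)` on `{0,1}^m` and `(A₂,B₂,C₂)` on `{0,1}^d` satisfying 3C-SAHI (events form) at all profiles, the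
disjunctions `(A₁ ∨ A₂, B₁ ∨ B₂, C₁ ∨ C₂)` (`1_{A₁∨A₂} = 1 − (1−1_{A₁})⊗(1−1_{A₂})`) satisfy it at all profiles. [this work] -/
theorem tc_orTens_setInd_nonneg (m : ℕ) {A₁ B₁ C₁ : Finset (Pt m)} {A₂ B₂ C₂ : Finset (Pt d)} (hA₁ : IsUpperSet (A₁ : Set (Pt m)))
    (hB₁ : IsUpperSet (B₁ : Set (Pt m))) (hC₁ : IsUpperSet (C₁ : Set (Pt m))) (hA₂ : IsUpperSet (A₂ : Set (Pt d)))
    (hB₂ : IsUpperSet (B₂ : Set (Pt d))) (hC₂ : IsUpperSet (C₂ : Set (Pt d))) (h₁ : ∀ bf, 0 ≤ tc bf (setInd A₁) (setInd B₁) (setInd C₁))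
    (h₂ : ∀ bb, 0 ≤ tc bb (setInd A₂) (setInd B₂) (setInd C₂)) (b : Fin (d + m) → ℕ) :
    0 ≤ tc b (orTens m (setInd A₁) (setInd A₂)) (orTens m (setInd B₁) (setInd B₂)) (orTens m (setInd C₁) (setInd C₂)) :=
  tc_orTens_nonneg_all m (setInd_nonneg _) (setInd_le_one'' _) (monotone_setInd hA₁) (setInd_nonneg _) (setInd_le_one'' _)
    (monotone_setInd hB₁) (setInd_nonneg _) (setInd_le_one'' _) (monotone_setInd hC₁) (setInd_nonneg _) (setInd_le_one'' _)
    (monotone_setInd hA₂) (setInd_nonneg _) (setInd_le_one'' _) (monotone_setInd hB₂) (setInd_nonneg _) (setInd_le_one'' _)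
    (monotone_setInd hC₂) h₁ h₂ b

end

end Summit.CriticalPhenomena.PercolationContinuityZ3.Theorems.SahiThreeCopy
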